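import Summits.CriticalPhenomena.PercolationContinuityZ3.Theorems.SahiMasterFamilySupport

/-!
# Lemma P: a terminal triple has no private coordinate

Companion of `SahiMasterFamilyMinors.lean` / `SahiMasterFamilySupport.lean` (unit `prim-master-conj`; the terminal
analysis of (T) = `SahiE3NonvanishingOfPairwiseDependent`).  This file formalises LEMMA P of the unit's paper proof
(STRUCTURE-PROOF.md §13, verified VERIFICATION-gen3.md):

* `not_both_minors_zeroFlag` — for increasing events `A, B, C` whose essential supports pairwise intersect and a
  coordinate `e` affecting neither `B` nor `C` (a coordinate PRIVATE to `A`, or a dummy), the two `e`-minors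
  `(A_e, B, C)` and `(A^e, B, C)` are NOT both in the zero-flag class `Z_3`.
  Proof (Kahn-style pivotality): `(B, C)` share a coordinate, so each minor is in `Z_3` via a pair containing the
  `A`-section, forcing one section `A*` to ignore `esupp C` and the other `A**` to ignore `esupp B`; Lemma Z then says no
  configuration of `A*` is `t`-pivotal for `B` (`t ∈ esupp C`) and no configuration of `B` is `s`-pivotal for `C`
  (`s ∈ esupp A**`).  Downward induction from the full configuration shows that the complement `Θ` of `esupp C` lies
  in `B`; a configuration witnessing `s ∈ esupp A ∩ esupp C`, filled up on `Θ`, is then a configuration of `B` that is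
  `s`-pivotal for `C` — contradiction.
* `esupp_subset_union_of_terminal` — consequently a terminal triple (`TerminalTriple`, all minors in `Z_3`) has no
  private coordinate in its first slot (the other slots by the symmetry lemmas `suppZeroFlag_three_swap…`).
Everything here is proved; axioms standard. [this work]
-/

noncomputable section

open scoped Classical

namespace Summit.CriticalPhenomena.PercolationContinuityZ3.Theorems

open Finset Function
open Literature.Probability.Percolation (DeterminedBy determinedBy_iff)
open Literature.Probability.LatticeModels.Kahn2022 (Affects)

variable {ι : Type*} [Fintype ι]

/-! ### Symmetries of `Z_2`, `ZVia`, `Z_3` (increasing events) -/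

/-- `Z_2` is symmetric. [folklore] -/
theorem suppZeroFlag_two_comm {X Y : Set (Set ι)} (hX : IsUpperSet X) (hY : IsUpperSet Y) :
    SuppZeroFlag 2 ![X, Y] ↔ SuppZeroFlag 2 ![Y, X] := by
  rw [suppZeroFlag_two_iff hX hY, suppZeroFlag_two_iff hY hX, disjoint_comm]

/-- `ZVia` is symmetric in the pair. [folklore] -/
theorem zVia_comm {X Y G : Set (Set ι)} (hX : IsUpperSet X) (hY : IsUpperSet Y) (hG : IsUpperSet G) :
    ZVia X Y G ↔ ZVia Y X G := by
  simp only [ZVia]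
  rw [suppZeroFlag_two_comm hX hY, suppZeroFlag_two_comm (hX.inter hG) hY, suppZeroFlag_two_comm hX (hY.inter hG)]
  tauto

/-- `Z_3` is invariant under swapping the first two events. [folklore] -/
theorem suppZeroFlag_three_swap12 {X Y G : Set (Set ι)} (hX : IsUpperSet X) (hY : IsUpperSet Y) (hG : IsUpperSet G) :
    SuppZeroFlag 3 ![X, Y, G] ↔ SuppZeroFlag 3 ![Y, X, G] := by
  rw [suppZeroFlag_three_iff_zVia, suppZeroFlag_three_iff_zVia, zVia_comm hY hG hX, zVia_comm hX hG hY,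
    zVia_comm hX hY hG]
  tauto

/-- `Z_3` is invariant under swapping the last two events. [folklore] -/
theorem suppZeroFlag_three_swap23 {X Y G : Set (Set ι)} (hX : IsUpperSet X) (hY : IsUpperSet Y) (hG : IsUpperSet G) :
    SuppZeroFlag 3 ![X, Y, G] ↔ SuppZeroFlag 3 ![X, G, Y] := by
  rw [suppZeroFlag_three_iff_zVia, suppZeroFlag_three_iff_zVia, zVia_comm hY hG hX]
  tauto

/-! ### The core pivotality argument -/

/-- The empty event has empty essential support. [folklore] -/
theorem esupp_empty : esupp (∅ : Set (Set ι)) = ∅ := by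
  ext i; simp [mem_esupp, affects_iff]

/-- An increasing event containing the full configuration and whose essential support avoids `esupp C` contains
every configuration that is full outside `esupp C`. [this work] -/
theorem mem_of_compl_esupp_subset {X C : Set (Set ι)} (hX : IsUpperSet X) (hXC : Disjoint (esupp X) (esupp C))
    (huniv : Set.univ ∈ X) {ω : Set ι} (hω : (↑(esupp C) : Set ι)ᶜ ⊆ ω) : ω ∈ X := by
  refine (mem_iff_of_inter_esupp_eq hX (ω := ω) (ω' := Set.univ) ?_).2 huniv
  ext i
  simp only [Set.mem_inter_iff, mem_coe, Set.mem_univ, true_and, and_iff_right_iff_imp]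
  intro hi
  exact hω fun hiC => Finset.disjoint_left.1 hXC hi hiC

/-- **Core of Lemma P.**  Increasing `A*, B, C` with `B` non-trivial, `A* ∋ univ`, `esupp A* ∩ esupp C = ∅`, no
configuration of `A*` `t`-pivotal for `B` (`t ∈ esupp C`), and a coordinate `s ∈ esupp C` at which no configuration of
`B` is pivotal for `C`: impossible. [this work] -/
theorem lemmaP_core {Astar B C : Set (Set ι)} (hAs : IsUpperSet Astar) (hB : IsUpperSet B) (hC : IsUpperSet C)
    (hBne : (esupp B).Nonempty) (huniv : Set.univ ∈ Astar) (hdisj : Disjoint (esupp Astar) (esupp C))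
    (hP : ∀ t ∈ esupp C, ∀ ω ∈ Astar, ω ∉ B → insert t ω ∉ B)
    {s : ι} (hsC : s ∈ esupp C) (hQ : ∀ ω ∈ B, ω ∉ C → insert s ω ∉ C) : False := by
  set Θ : Set ι := (↑(esupp C) : Set ι)ᶜ with hΘ
  -- Step 1: `Θ ∪ (esupp C ∖ ρ) ∈ B` for every `ρ ⊆ esupp C`, by induction on `ρ`
  have step : ∀ ρ : Finset ι, ρ ⊆ esupp C → Θ ∪ ↑(esupp C \ ρ) ∈ B := by
    intro ρ
    induction ρ using Finset.induction_on with
    | empty =>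
      intro _
      rw [Finset.sdiff_empty, hΘ, Set.compl_union_self]
      exact univ_mem_of_nonempty hB (nonempty_of_esupp_nonempty hBne).1
    | insert t ρ htρ ih =>
      intro hsub
      have htC : t ∈ esupp C := hsub (mem_insert_self t ρ)
      have hρ : ρ ⊆ esupp C := fun i hi => hsub (mem_insert_of_mem hi)
      have hprev := ih hρ
      have heq : Θ ∪ ↑(esupp C \ ρ) = insert t (Θ ∪ ↑(esupp C \ insert t ρ)) := by
        ext i
        simp only [Set.mem_union, mem_coe, mem_sdiff, Finset.mem_insert, Set.mem_insert_iff, not_or]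
        constructor
        · rintro (hi | ⟨hiC, hiρ⟩)
          · exact Or.inr (Or.inl hi)
          · by_cases hit : i = t
            · exact Or.inl hit
            · exact Or.inr (Or.inr ⟨hiC, hit, hiρ⟩)
        · rintro (rfl | hi | ⟨hiC, -, hiρ⟩)
          · exact Or.inr ⟨htC, htρ⟩
          · exact Or.inl hi
          · exact Or.inr ⟨hiC, hiρ⟩
      rw [heq] at hprev
      by_contra hω
      have hωA : Θ ∪ ↑(esupp C \ insert t ρ) ∈ Astar :=
        mem_of_compl_esupp_subset hAs hdisj huniv Set.subset_union_left
      exact hP t htC _ hωA hω hprev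
  have hΘB : Θ ∈ B := by
    have := step (esupp C) subset_rfl
    rwa [Finset.sdiff_self, coe_empty, Set.union_empty] at this
  -- Step 2: a configuration witnessing `s ∈ esupp C`, filled on `Θ`, lies in `B` and is `s`-pivotal for `C`
  obtain ⟨θ, hθC, hsθ⟩ := mem_esupp.1 hsC
  have hagree : ∀ η : Set ι, (η ∪ Θ) ∩ ↑(esupp C) = η ∩ ↑(esupp C) := by
    intro η; ext i
    simp only [Set.mem_inter_iff, Set.mem_union, hΘ, Set.mem_compl_iff, mem_coe]
    tauto
  have h1 : θ ∪ Θ ∉ C := fun h => hθC ((mem_iff_of_inter_esupp_eq hC (hagree θ)).1 h)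
  have h2 : insert s (θ ∪ Θ) ∈ C := by
    rw [← Set.insert_union]
    exact (mem_iff_of_inter_esupp_eq hC (hagree (insert s θ))).2 hsθ
  exact hQ (θ ∪ Θ) (hB Set.subset_union_right hΘB) h1 h2

/-! ### Lemma P -/

/-- **Lemma P.**  Let `A, B, C` be increasing events whose essential supports pairwise intersect, and let `e` affect
neither `B` nor `C`.  Then the two `e`-minors `(A_e, B, C)` and `(A^e, B, C)` are not both in `Z_3`.  (For `e`
affecting `A` this is the exclusion of private coordinates from the terminal class; for a dummy `e` both minors are
`(A, B, C)` itself, which is pairwise dependent.) [this work] -/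
theorem not_both_minors_zeroFlag {A B C : Set (Set ι)} (hA : IsUpperSet A) (hB : IsUpperSet B) (hC : IsUpperSet C)
    (hAB : (esupp A ∩ esupp B).Nonempty) (hAC : (esupp A ∩ esupp C).Nonempty) (hBC : (esupp B ∩ esupp C).Nonempty)
    {e : ι} (heB : e ∉ esupp B) (heC : e ∉ esupp C)
    (h0 : SuppZeroFlag 3 ![secAt e false A, B, C]) (h1 : SuppZeroFlag 3 ![secAt e true A, B, C]) : False := by
  have hA0 : IsUpperSet (secAt e false A) := isUpperSet_secAt e false hA
  have hA1 : IsUpperSet (secAt e true A) := isUpperSet_secAt e true hA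
  have hBne : (esupp B).Nonempty := by obtain ⟨i, hi⟩ := hAB; exact ⟨i, (mem_inter.1 hi).2⟩
  -- each minor is realised by a pair containing the `A`-section
  have opt : ∀ {Av : Set (Set ι)}, IsUpperSet Av → SuppZeroFlag 3 ![Av, B, C] → ZVia Av C B ∨ ZVia Av B C := by
    intro Av hAv h
    rcases (suppZeroFlag_three_iff_zVia Av B C).1 h with h | h | h
    · exact absurd h (not_zVia_of_inter_nonempty hB hC hBC)
    · exact Or.inl h
    · exact Or.inr h
  -- the core, for a section `A*` ignoring `C` (with its `B`-pivotality exclusion) and `A**` ignoring `B`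
  have finish : ∀ {As Ass : Set (Set ι)}, IsUpperSet As → IsUpperSet Ass →
      (∀ f ∈ esupp A, f ≠ e → f ∈ esupp As ∨ f ∈ esupp Ass) →
      ZVia As C B → ZVia Ass B C → Set.univ ∈ As → False := by
    intro As Ass hAs hAss hsplit hZC hZB huniv
    obtain ⟨dAsC, hPAs, -⟩ := zVia_pivotal hAs hC hB hZC
    obtain ⟨dAssB, -, hQAss⟩ := zVia_pivotal hAss hB hC hZB
    -- a coordinate of `esupp A ∩ esupp C` lies in `esupp A**`
    obtain ⟨s, hs⟩ := hAC
    have hsC := (mem_inter.1 hs).2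
    have hse : s ≠ e := fun hse => heC (hse ▸ hsC)
    have hsAss : s ∈ esupp Ass := by
      rcases hsplit s (mem_inter.1 hs).1 hse with h | h
      · exact absurd hsC (Finset.disjoint_left.1 dAsC h)
      · exact h
    exact lemmaP_core hAs hB hC hBne huniv dAsC hPAs hsC (hQAss s hsAss)
  -- `univ` lies in a section as soon as the section is nonempty; nonemptiness from the other section ignoring `B`
  have huniv_of : ∀ {As : Set (Set ι)}, IsUpperSet As → (As = ∅ → False) → Set.univ ∈ As := by
    intro As hAs hne
    by_cases h : As.Nonempty
    · exact univ_mem_of_nonempty hAs h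
    · exact absurd (Set.not_nonempty_iff_eq_empty.1 h) hne
  -- nonemptiness of the `C`-ignoring section: otherwise `esupp A ∩ esupp B` would sit inside the `B`-ignoring one
  have hne_of : ∀ {As Ass : Set (Set ι)},
      (∀ f ∈ esupp A, f ≠ e → f ∈ esupp As ∨ f ∈ esupp Ass) → Disjoint (esupp Ass) (esupp B) → As = ∅ → False := by
    intro As Ass hsplit dAssB hAs0
    obtain ⟨f, hf⟩ := hAB
    have hfB := (mem_inter.1 hf).2
    have hfe : f ≠ e := fun hfe => heB (hfe ▸ hfB)
    rcases hsplit f (mem_inter.1 hf).1 hfe with h | h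
    · rw [hAs0, esupp_empty] at h; exact absurd h (Finset.notMem_empty f)
    · exact Finset.disjoint_left.1 dAssB h hfB
  have hsplit01 : ∀ f ∈ esupp A, f ≠ e → f ∈ esupp (secAt e false A) ∨ f ∈ esupp (secAt e true A) :=
    fun f hf hfe => mem_esupp_secAt_or hf hfe
  have hsplit10 : ∀ f ∈ esupp A, f ≠ e → f ∈ esupp (secAt e true A) ∨ f ∈ esupp (secAt e false A) :=
    fun f hf hfe => (mem_esupp_secAt_or hf hfe).symm
  rcases opt hA0 h0 with h0C | h0B <;> rcases opt hA1 h1 with h1C | h1B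
  · -- both sections ignore `C`: impossible
    obtain ⟨s, hs⟩ := hAC
    have hsC := (mem_inter.1 hs).2
    rcases mem_esupp_secAt_or (mem_inter.1 hs).1 (fun hse : s = e => heC (hse ▸ hsC)) with h | h
    · exact Finset.disjoint_left.1 (zVia_pivotal hA0 hC hB h0C).1 h hsC
    · exact Finset.disjoint_left.1 (zVia_pivotal hA1 hC hB h1C).1 h hsC
  · -- P2: `A_e` ignores `C`, `A^e` ignores `B`
    have dB := (zVia_pivotal hA1 hB hC h1B).1
    exact finish hA0 hA1 hsplit01 h0C h1B (huniv_of hA0 (hne_of hsplit01 dB))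
  · -- P1: `A^e` ignores `C`, `A_e` ignores `B`
    have dB := (zVia_pivotal hA0 hB hC h0B).1
    exact finish hA1 hA0 hsplit10 h1C h0B (huniv_of hA1 (hne_of hsplit10 dB))
  · -- both sections ignore `B`: impossible
    obtain ⟨f, hf⟩ := hAB
    have hfB := (mem_inter.1 hf).2
    rcases mem_esupp_secAt_or (mem_inter.1 hf).1 (fun hfe : f = e => heB (hfe ▸ hfB)) with h | h
    · exact Finset.disjoint_left.1 (zVia_pivotal hA0 hB hC h0B).1 h hfB
    · exact Finset.disjoint_left.1 (zVia_pivotal hA1 hB hC h1B).1 h hfB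

/-! ### Consequence for terminal triples -/

/-- **No private coordinate in a terminal triple (first slot).**  In a terminal triple of increasing events every
coordinate affecting `U_0` affects `U_1` or `U_2`. [this work] -/
theorem esupp_subset_union_of_terminal {U : Fin 3 → Set (Set ι)} {S : Finset ι} (hU : ∀ j, IsUpperSet (U j))
    (hUS : ∀ j, DeterminedBy (U j) (↑S : Set ι)) (hT : TerminalTriple U S) :
    esupp (U 0) ⊆ esupp (U 1) ∪ esupp (U 2) := by
  intro e he
  by_contra hnot
  rw [mem_union, not_or] at hnot
  obtain ⟨hPD, -, hmin⟩ := hT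
  have heS : e ∈ S := esupp_subset_of_determinedBy (hUS 0) he
  -- pairwise dependence gives pairwise-intersecting essential supports
  have hdep : ∀ {X Y : Set (Set ι)}, IsUpperSet X → IsUpperSet Y → ¬ SuppZeroFlag 2 ![X, Y] →
      (esupp X ∩ esupp Y).Nonempty := by
    intro X Y hX hY h
    by_contra hne
    rw [Finset.not_nonempty_iff_eq_empty] at hne
    exact h ((suppZeroFlag_two_iff hX hY).2 (Finset.disjoint_iff_inter_eq_empty.2 hne))
  have e12 : (fun j : Fin 2 => U ((0 : Fin 3).succAbove j)) = ![U 1, U 2] := by funext j; fin_cases j <;> rfl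
  have e02 : (fun j : Fin 2 => U ((1 : Fin 3).succAbove j)) = ![U 0, U 2] := by funext j; fin_cases j <;> rfl
  have e01 : (fun j : Fin 2 => U ((2 : Fin 3).succAbove j)) = ![U 0, U 1] := by funext j; fin_cases j <;> rfl
  have h12 := hPD 0; rw [e12] at h12
  have h02 := hPD 1; rw [e02] at h02
  have h01 := hPD 2; rw [e01] at h01
  -- the minors at `e`, with `U_1`, `U_2` unchanged
  have hsec : ∀ b : Bool, (fun j => secAt e b (U j)) = ![secAt e b (U 0), U 1, U 2] := by
    intro b
    funext j
    fin_cases j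
    · rfl
    · exact secAt_eq_self_of_not_affects (hU 1) (fun h => hnot.1 (mem_esupp.2 h)) b
    · exact secAt_eq_self_of_not_affects (hU 2) (fun h => hnot.2 (mem_esupp.2 h)) b
  have h0 := hmin e heS false; rw [hsec false] at h0
  have h1 := hmin e heS true; rw [hsec true] at h1
  exact not_both_minors_zeroFlag (hU 0) (hU 1) (hU 2) (hdep (hU 0) (hU 1) h01) (hdep (hU 0) (hU 2) h02)
    (hdep (hU 1) (hU 2) h12) hnot.1 hnot.2 h0 h1

end Summit.CriticalPhenomena.PercolationContinuityZ3.Theorems
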